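/-
Origin: expansion seat `prover-pub-hodgecm-mc-binder-2-g12-0`, handover #62 2026-08-20T06:40Z md5 64f806b4209c (286 l.; CERTIFIED same mirror: rc 0 / 0 err / 0 warn / 36 s; `#print axioms` of lettEquiv · lettInvArch_mem · archFrameConjEquiv ⊆ trio (`g12/certs/axioms-62.log`); imports #50 `KInfLetters` (RUN 41) only; (J-dense)(iv-0) = (J-x₀) COMPLETED: **`lettEquiv V S : ↥(KInfty V) ≃* Π_w U(V⁺_w) × U(V⁻_w)`** — #50's lettering IS A BIJECTION. §1 `inv_congr_of_congr` (`ᵗ(g⁻¹)‾ · diag d · g⁻¹ = H` from `ᵗḡ H g = diag d`), **`archFrameConjInv`** (`y ↦ g y g⁻¹ : U(diag d)(L⁺⊗ℝ) →* U(H)(L⁺⊗ℝ)`, #40 `inv_conj_mem_arch_of_congr` at `g⁻¹`), `coe_archFrameConjInv`, `archFrameConj_archFrameConjInv`, `archFrameConjInv_archFrameConj`, **`archFrameConjEquiv : U(H)(L⁺⊗ℝ) ≃* U(diag d)(L⁺⊗ℝ)`**; §2 `kVLettersHom` (+`_apply` rfl: `= kVLetters`), `lettInvArch := archFrameConjInv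 ∘ fst ∘ letterSection ∘ kVLettersHom`, `archFrameConj_lettInvArch`, `coe_archAt_cmPlaceOver_archFrameConj` (#50's in-proof `hX` as a lemma: the `w(ι₁)`-matrix of `frameG⁻¹ k frameG` for ANY k via `π k`, `embTwist`, `sylvesterScale`, `rationalFramePerm`), `smul_x₀_eq_of_col_two` (`u • x₀ = x₀` from `u_{i2} = 0`, tree `smul_x₀_val`), `pos_perm_castSucc`, **`lettInvArch_mem : lettInvArch V S a ∈ KInfty V`** (the ι₁-component of `frameG⁻¹ (lettInvArch a) frameG` is the block-diagonal letter `kV (a v₁)` by #41 `cmPlaceComponent_letterSection`, so `π(lettInvArch a)` has vanishing (pos, σ2) entries and fixes `x₀` — the CONVERSE of #50 `cmPlaceComponent_fst_mem_range_cmPlace`), `lettInv` (codRestrict), `coe_lettInv`, `lett_lettInv` (`UForm.kV_injective`), `lettInv_lett` (`archFrameConjEquiv` injective + #50 `letterSection_lett`), `lettEquiv`, `lettEquiv_apply`, `lett_surjective`; USE: K_∞-isotypy of a polynomial (#59/#61 `pinIsotypicPolys`/`detIsotypicPolys`) ⟺ isotypy under EVERY letter family `a`, in particular single-place families — the input shape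 of tree `PolynomialPlaceIsotypic.mem_span_placeProducts_of_isPlaceIsotypic` for (J-dense)(iv); 0 Prop-defs / 0 records / 0 proof-hole-class tokens; FQN scan vs PKG RUN-42 world + mc/*/pkg + stage4*: 0 collisions; NAME LIST `HodgeCM.Model.HypCensus.lettEquiv` · `HodgeCM.Model.HypCensus.lettInvArch_mem` · `HodgeCM.Model.HypCensus.archFrameConjEquiv`) (`HOME/mc/pub-hodgecm-mc-binder-2/g12/pkg/HodgeCM/Model/HypCensus/LettEquiv.lean`, md5 64f806b4209c, 286 lines);
landed by the gen-16 packager (p-g16) in gate run 43 as `HodgeCM/Model/HypCensus/LettEquiv.lean` (verbatim).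
-/
/-
Copyright (c) 2026. All rights reserved.
Released under Apache 2.0 license as described in the file LICENSE.
-/
import Summits.HodgeConjecture.HodgeCM.Model.HypCensus.KInfLetters

/-!
# The lettering of `K_∞` is a BIJECTION onto `Π_w U(V⁺_w) × U(V⁻_w)`

Binder-2 lineage, rows 18/19 (`hyp12`/`hyp34`); (J-dense) step (iv-0).

#50 constructed `lett V S : K_∞ →* Π_w U(V⁺_w) × U(V⁻_w)` with `letterSection (kVLetters (lett k)) = (frameG⁻¹ k frameG, 1)`.
Here the INVERSE: for a letter family `a`, `lettInv a := frameG · (letterSection (kVLetters a)).1 · frameG⁻¹` lies in `K_∞`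
(its `w(ι₁)`-component is block-diagonal in the Sylvester frame of record, hence `π(lettInv a)` fixes the base point `x₀`),
and `lett (lettInv a) = a`, `lettInv (lett k) = k`: **`lettEquiv : K_∞ ≃* Π_w U(V⁺_w) × U(V⁻_w)`**.
Consequence for (J-dense)(iv): `K_∞`-isotypy of a polynomial is isotypy under EVERY letter family, in particular under the
single-place families — the input shape of the tree's `PolynomialPlaceIsotypic`.

* §1 `inv_congr_of_congr`, `archFrameConjInv` (`y ↦ g y g⁻¹ : U(diag d)(L⊗ℝ) →* U(H)(L⊗ℝ)`), `archFrameConj_archFrameConjInv`,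
  `archFrameConjInv_archFrameConj`, `archFrameConjEquiv`.
* §2 `kVLettersHom`, `lettInvArch`, `archFrameConj_lettInvArch`, `coe_archAt_cmPlaceOver_archFrameConj` (the `w(ι₁)`-matrix of
  `frameG⁻¹ k frameG` for ANY `k`, #50's `hX` as a lemma), `smul_x₀_eq_of_col_two` (`u • x₀ = x₀` from `u_{i2} = 0`),
  **`lettInvArch_mem`**, `lettInv`, `lett_lettInv`, `lettInv_lett`, **`lettEquiv`**, `lett_surjective`.
[folklore]
-/

noncomputable section

open NumberField NumberField.InfinitePlace
open scoped Matrix Classical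
open Literature.NumberTheory.Automorphic Literature.NumberTheory.Automorphic.UnitaryGroup Literature.NumberTheory.Weil1964
open Literature.RepresentationTheory.KonnoKonno2007 Literature.RepresentationTheory.KonnoKonno2007.RealDualPair
open Literature.NumberTheory.GelbartRogawski1991 Literature.NumberTheory.GelbartRogawski1991.UnitaryDualPair
open Literature.Analysis.SegalBargmann
open Literature.Geometry.ComplexHyperbolic Literature.Geometry.ComplexHyperbolic.BallModel

namespace HodgeCM.Model.HypCensus

/-! ## §1 the inverse frame conjugation -/

section Frame

variable (L : Type) [Field L] [NumberField L] [IsCMField L] (N : ℕ)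
variable (H : Matrix (Fin N) (Fin N) L) (g : GL (Fin N) L) (d : Fin N → L)
  (hg : ((g : Matrix (Fin N) (Fin N) L).map (cmConjRingHom L))ᵀ * H * (g : Matrix (Fin N) (Fin N) L) = Matrix.diagonal d)

include hg in
/-- the congruence for the inverse frame: `ᵗ(g⁻¹)‾ · diag d · g⁻¹ = H`. -/
theorem inv_congr_of_congr :
    (((g⁻¹ : GL (Fin N) L) : Matrix (Fin N) (Fin N) L).map (cmConjRingHom L))ᵀ * Matrix.diagonal d *
        ((g⁻¹ : GL (Fin N) L) : Matrix (Fin N) (Fin N) L) = H := by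
  rw [← hg]
  have h1 : (((g⁻¹ : GL (Fin N) L) : Matrix (Fin N) (Fin N) L).map (cmConjRingHom L))ᵀ *
      ((g : Matrix (Fin N) (Fin N) L).map (cmConjRingHom L))ᵀ = 1 := by
    rw [← Matrix.transpose_mul, ← Matrix.map_mul, ← Units.val_mul, mul_inv_cancel, Units.val_one,
      Matrix.map_one _ (map_zero _) (map_one _), Matrix.transpose_one]
  have h2 : (g : Matrix (Fin N) (Fin N) L) * ((g⁻¹ : GL (Fin N) L) : Matrix (Fin N) (Fin N) L) = 1 := by
    rw [← Units.val_mul, mul_inv_cancel, Units.val_one]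
  calc (((g⁻¹ : GL (Fin N) L) : Matrix (Fin N) (Fin N) L).map (cmConjRingHom L))ᵀ *
        (((g : Matrix (Fin N) (Fin N) L).map (cmConjRingHom L))ᵀ * H * (g : Matrix (Fin N) (Fin N) L)) *
          ((g⁻¹ : GL (Fin N) L) : Matrix (Fin N) (Fin N) L)
      = ((((g⁻¹ : GL (Fin N) L) : Matrix (Fin N) (Fin N) L).map (cmConjRingHom L))ᵀ *
          ((g : Matrix (Fin N) (Fin N) L).map (cmConjRingHom L))ᵀ) * H *
            ((g : Matrix (Fin N) (Fin N) L) * ((g⁻¹ : GL (Fin N) L) : Matrix (Fin N) (Fin N) L)) := by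
        simp only [Matrix.mul_assoc]
    _ = H := by rw [h1, h2, Matrix.one_mul, Matrix.mul_one]

/-- **`y ↦ g y g⁻¹ : U(diag d)(L⁺ ⊗ ℝ) →* U(H)(L⁺ ⊗ ℝ)`**, the inverse frame conjugation. -/
def archFrameConjInv :
    ↥(UnitaryGroup.arch (↥(maximalRealSubfield L)) L (IsCMField.complexConj L) N (Matrix.diagonal d)) →*
      ↥(UnitaryGroup.arch (↥(maximalRealSubfield L)) L (IsCMField.complexConj L) N H) where
  toFun y := ⟨(archGLn L N g⁻¹)⁻¹ * y * archGLn L N g⁻¹,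
    inv_conj_mem_arch_of_congr L N g⁻¹ (Matrix.diagonal d) H (inv_congr_of_congr L N H g d hg) y.2⟩
  map_one' := Subtype.ext (by simp only [OneMemClass.coe_one, mul_one, inv_mul_cancel])
  map_mul' k k' := Subtype.ext (by simp only [Subgroup.coe_mul, mul_assoc, mul_inv_cancel_left])

/-- (Ported verbatim from the HodgeCMPerL package; no docstring in the source.) -/
@[simp] theorem coe_archFrameConjInv
    (y : ↥(UnitaryGroup.arch (↥(maximalRealSubfield L)) L (IsCMField.complexConj L) N (Matrix.diagonal d))) :
    ((archFrameConjInv L N H g d hg y : ↥(UnitaryGroup.arch (↥(maximalRealSubfield L)) L (IsCMField.complexConj L) N H)) :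
      GL (Fin N) (mixedEmbedding.mixedSpace L)) = archGLn L N g * y * (archGLn L N g)⁻¹ := by
  change (archGLn L N g⁻¹)⁻¹ * (y : GL (Fin N) (mixedEmbedding.mixedSpace L)) * archGLn L N g⁻¹ = _
  rw [map_inv, inv_inv]

/-- (Ported verbatim from the HodgeCMPerL package; no docstring in the source.) -/
theorem archFrameConj_archFrameConjInv
    (y : ↥(UnitaryGroup.arch (↥(maximalRealSubfield L)) L (IsCMField.complexConj L) N (Matrix.diagonal d))) :
    archFrameConj L N H g d hg (archFrameConjInv L N H g d hg y) = y := by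
  apply Subtype.ext
  rw [coe_archFrameConj, coe_archFrameConjInv]
  group

/-- (Ported verbatim from the HodgeCMPerL package; no docstring in the source.) -/
theorem archFrameConjInv_archFrameConj
    (k : ↥(UnitaryGroup.arch (↥(maximalRealSubfield L)) L (IsCMField.complexConj L) N H)) :
    archFrameConjInv L N H g d hg (archFrameConj L N H g d hg k) = k := by
  apply Subtype.ext
  rw [coe_archFrameConjInv, coe_archFrameConj]
  group

/-- **`U(H)(L⁺ ⊗ ℝ) ≃* U(diag d)(L⁺ ⊗ ℝ)`** along the rational frame `g`. -/
def archFrameConjEquiv :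
    ↥(UnitaryGroup.arch (↥(maximalRealSubfield L)) L (IsCMField.complexConj L) N H) ≃*
      ↥(UnitaryGroup.arch (↥(maximalRealSubfield L)) L (IsCMField.complexConj L) N (Matrix.diagonal d)) :=
  { archFrameConj L N H g d hg with
    invFun := archFrameConjInv L N H g d hg
    left_inv := archFrameConjInv_archFrameConj L N H g d hg
    right_inv := archFrameConj_archFrameConjInv L N H g d hg }

/-- (Ported verbatim from the HodgeCMPerL package; no docstring in the source.) -/
@[simp] theorem archFrameConjEquiv_apply (k : ↥(UnitaryGroup.arch (↥(maximalRealSubfield L)) L (IsCMField.complexConj L) N H)) :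
    archFrameConjEquiv L N H g d hg k = archFrameConj L N H g d hg k := rfl

end Frame

/-! ## §2 at the pin: the inverse lettering -/

section Pin

variable {L : CMField} {ι₁ : L →+* ℂ} (V : HermSpace3 L ι₁) (S : StubTree.SeesawDatum L)

/-- the full letter family `(a_w, (1,1))_w` as a hom. -/
def kVLettersHom :
    (∀ w : {v : InfinitePlace ↥(maximalRealSubfield L) // v.IsReal},
      Matrix.unitaryGroup (PosIdx (cmXV (L : Type) (frameD V) (frameD_real V) ι₁ w)) ℂ ×
        Matrix.unitaryGroup (NegIdx (cmXV (L : Type) (frameD V) (frameD_real V) ι₁ w)) ℂ) →*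
      ∀ w : {v : InfinitePlace ↥(maximalRealSubfield L) // v.IsReal},
        DPK (PosIdx (cmXV (L : Type) (frameD V) (frameD_real V) ι₁ w)) (NegIdx (cmXV (L : Type) (frameD V) (frameD_real V) ι₁ w))
          (PosIdx (cmXW (L : Type) (frameD V) (dW S) (dW_real S) ι₁ w)) (NegIdx (cmXW (L : Type) (frameD V) (dW S) (dW_real S) ι₁ w)) :=
  MonoidHom.pi fun w => ((Pi.evalMonoidHom _ w).prod 1)

/-- (Ported verbatim from the HodgeCMPerL package; no docstring in the source.) -/
@[simp] theorem kVLettersHom_apply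
    (a : ∀ w : {v : InfinitePlace ↥(maximalRealSubfield L) // v.IsReal},
      Matrix.unitaryGroup (PosIdx (cmXV (L : Type) (frameD V) (frameD_real V) ι₁ w)) ℂ ×
        Matrix.unitaryGroup (NegIdx (cmXV (L : Type) (frameD V) (frameD_real V) ι₁ w)) ℂ) :
    kVLettersHom V S a = fun w => (a w, (1, 1)) := rfl

/-- `a ↦ frameG · (letterSection (a_w, (1,1))_w).1 · frameG⁻¹ ∈ U(V.Hm)(L ⊗ ℝ)`. -/
def lettInvArch :
    (∀ w : {v : InfinitePlace ↥(maximalRealSubfield L) // v.IsReal},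
      Matrix.unitaryGroup (PosIdx (cmXV (L : Type) (frameD V) (frameD_real V) ι₁ w)) ℂ ×
        Matrix.unitaryGroup (NegIdx (cmXV (L : Type) (frameD V) (frameD_real V) ι₁ w)) ℂ) →*
      ↥(UnitaryGroup.arch (↥(maximalRealSubfield L)) (L : Type) (IsCMField.complexConj L) 3 V.Hm) :=
  (archFrameConjInv (L : Type) 3 V.Hm (frameG V) (frameD V) (frame_congr V)).comp
    ((MonoidHom.fst _ _).comp
      ((letterSection (L : Type) (frameD V) (frameD_real V) (frameD_ne V) (dW S) (dW_real S) (dW_ne S) ι₁).comp (kVLettersHom V S)))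

/-- (Ported verbatim from the HodgeCMPerL package; no docstring in the source.) -/
theorem archFrameConj_lettInvArch
    (a : ∀ w : {v : InfinitePlace ↥(maximalRealSubfield L) // v.IsReal},
      Matrix.unitaryGroup (PosIdx (cmXV (L : Type) (frameD V) (frameD_real V) ι₁ w)) ℂ ×
        Matrix.unitaryGroup (NegIdx (cmXV (L : Type) (frameD V) (frameD_real V) ι₁ w)) ℂ) :
    archFrameConj (L : Type) 3 V.Hm (frameG V) (frameD V) (frame_congr V) (lettInvArch V S a) =
      (letterSection (L : Type) (frameD V) (frameD_real V) (frameD_ne V) (dW S) (dW_real S) (dW_ne S) ι₁ fun w => (a w, (1, 1))).1 := by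
  simp only [lettInvArch, MonoidHom.comp_apply, MonoidHom.coe_fst, kVLettersHom_apply]
  exact archFrameConj_archFrameConjInv (L : Type) 3 V.Hm (frameG V) (frameD V) (frame_congr V) _

/-- **the `w(ι₁)`-matrix of `frameG⁻¹ k frameG` for ANY `k`** (#50 `coe_archAt_cmPlace_archFrameConj`, read at `cmPlaceOver (cmPlace ι₁)`). -/
theorem coe_archAt_cmPlaceOver_archFrameConj
    (k : UnitaryGroup.arch (↥(maximalRealSubfield L)) (L : Type) (IsCMField.complexConj L) 3 V.Hm) (i j : Fin 3) :
    (((archAt (↥(maximalRealSubfield L)) (L : Type) (IsCMField.complexConj L) 3 (Matrix.diagonal (frameD V))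
        (cmPlaceOver (L : Type) (cmPlace (L : Type) ι₁)) (cmPlaceOver_smul (L : Type) _) (IsCMField.complexConj_ne_one (L : Type))
        (archFrameConj (L : Type) 3 V.Hm (frameG V) (frameD V) (frame_congr V) k) :
          archLocal (L : Type) 3 (Matrix.diagonal (frameD V)) (cmPlaceOver (L : Type) (cmPlace (L : Type) ι₁))) : GL (Fin 3) ℂ) :
            Matrix (Fin 3) (Fin 3) ℂ) i j =
      ((V.sylvesterScale (V.rationalFramePerm.symm i) : ℝ) : ℂ) *
        embTwist (L : Type) ι₁ (mat (archProjU21EmbCM (L : Type) V.Hm ι₁ V.sylvesterFrame (sylvesterFrame_formCongr V) k)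
          (V.rationalFramePerm.symm i) (V.rationalFramePerm.symm j)) *
        (((V.sylvesterScale (V.rationalFramePerm.symm j) : ℝ) : ℂ))⁻¹ := by
  rw [coe_archAt_eq_of_eq V (cmPlaceOver_cmPlace_eq (L := L) (ι₁ := ι₁)) _ (UnitaryGroup.complexConj_smul_infinitePlace (L : Type) _),
    coe_archAt_cmPlace_archFrameConj, Matrix.submatrix_apply, Matrix.mul_diagonal, Matrix.diagonal_mul, Matrix.map_apply]

/-- `u • x₀ = x₀` as soon as the last column of `u` vanishes above the diagonal. -/
theorem smul_x₀_eq_of_col_two (u : U21) (h : ∀ m : Fin 2, mat u (Fin.castSucc m) 2 = 0) : u • x₀ = x₀ :=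
  Ball.ext fun i => by rw [smul_x₀_val, h i, zero_div, x₀_val, Pi.zero_apply]

/-- positivity bookkeeping in the Sylvester frame of record: `σ (castSucc m)` is a positive index … -/
theorem pos_perm_castSucc (m : Fin 2) :
    0 < cmXV (L : Type) (frameD V) (frameD_real V) ι₁ (cmPlace (L : Type) ι₁) (V.rationalFramePerm (Fin.castSucc m)) := by
  by_contra h
  have h2 := V.rationalFramePerm.injective (eq_perm_two_of_not_pos V h)
  exact (Fin.castSucc_lt_last m).ne h2

/-- **the inverse lettering lands in `K_∞`**: the `w(ι₁)`-component of `frameG⁻¹ (lettInvArch a) frameG` is the block-diagonal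
letter `diag(a⁺, a⁻)`, so `π(lettInvArch a)` is block-diagonal in the Sylvester frame and fixes `x₀`. -/
theorem lettInvArch_mem
    (a : ∀ w : {v : InfinitePlace ↥(maximalRealSubfield L) // v.IsReal},
      Matrix.unitaryGroup (PosIdx (cmXV (L : Type) (frameD V) (frameD_real V) ι₁ w)) ℂ ×
        Matrix.unitaryGroup (NegIdx (cmXV (L : Type) (frameD V) (frameD_real V) ι₁ w)) ℂ) :
    lettInvArch V S a ∈ KInfty V := by
  rw [KInfty, mem_archIsotropy_iff]
  set k := lettInvArch V S a with hk
  -- the block-diagonal statement at `w(ι₁)`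
  have hcomp : (cmPlaceComponent (L : Type) (frameD V) (frameD_real V) (frameD_ne V) (dW S) (dW_real S) (dW_ne S) ι₁
      (cmPlace (L : Type) ι₁) (archFrameConj (L : Type) 3 V.Hm (frameG V) (frameD V) (frame_congr V) k,
        (1 : UnitaryGroup.arch (↥(maximalRealSubfield L)) (L : Type) (IsCMField.complexConj L) 2 (Matrix.diagonal (dW S))))).1 =
      UForm.kV _ _ (a (cmPlace (L : Type) ι₁)) := by
    have h1 := congrArg Prod.fst (cmPlaceComponent_letterSection (L : Type) (frameD V) (frameD_real V) (frameD_ne V) (dW S)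
      (dW_real S) (dW_ne S) ι₁ (cmPlace (L : Type) ι₁) (fun w => (a w, (1, 1))))
    rw [cmPlaceComponent_fst] at h1 ⊢
    rw [hk, archFrameConj_lettInvArch]
    have h1' : _ = UForm.kV _ _ (a (cmPlace (L : Type) ι₁)) := h1
    exact h1'
  have hentry : ∀ (p : PosIdx (cmXV (L : Type) (frameD V) (frameD_real V) ι₁ (cmPlace (L : Type) ι₁)))
      (n : NegIdx (cmXV (L : Type) (frameD V) (frameD_real V) ι₁ (cmPlace (L : Type) ι₁))),
      mat (archProjU21EmbCM (L : Type) V.Hm ι₁ V.sylvesterFrame (sylvesterFrame_formCongr V) k)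
        (V.rationalFramePerm.symm p.1) (V.rationalFramePerm.symm n.1) = 0 := by
    intro p n
    have h := congrArg
      (fun u : UForm (PosIdx (cmXV (L : Type) (frameD V) (frameD_real V) ι₁ (cmPlace (L : Type) ι₁)))
        (NegIdx (cmXV (L : Type) (frameD V) (frameD_real V) ι₁ (cmPlace (L : Type) ι₁))) =>
        ((u : GL (PosIdx (cmXV (L : Type) (frameD V) (frameD_real V) ι₁ (cmPlace (L : Type) ι₁)) ⊕
            NegIdx (cmXV (L : Type) (frameD V) (frameD_real V) ι₁ (cmPlace (L : Type) ι₁))) ℂ) :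
          Matrix (PosIdx (cmXV (L : Type) (frameD V) (frameD_real V) ι₁ (cmPlace (L : Type) ι₁)) ⊕
              NegIdx (cmXV (L : Type) (frameD V) (frameD_real V) ι₁ (cmPlace (L : Type) ι₁)))
            (PosIdx (cmXV (L : Type) (frameD V) (frameD_real V) ι₁ (cmPlace (L : Type) ι₁)) ⊕
              NegIdx (cmXV (L : Type) (frameD V) (frameD_real V) ι₁ (cmPlace (L : Type) ι₁))) ℂ) (Sum.inl p) (Sum.inr n)) hcomp
    simp only [coe_cmPlaceComponent_fst, Matrix.reindex_apply, Matrix.submatrix_apply, cmEpsV_symm_inl, cmEpsV_symm_inr,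
      scaleConj_apply, coe_archAt_cmPlaceOver_archFrameConj, UForm.coe_kV, Matrix.fromBlocks_apply₁₂, Matrix.zero_apply] at h
    have hD := cmDV_ne_zero (L : Type) (frameD V) (frameD_real V) (frameD_ne V) ι₁ (cmPlace (L : Type) ι₁)
    have hs := sylvesterScale_coe_ne_zero V
    rcases mul_eq_zero.1 h with h | h
    · rcases mul_eq_zero.1 h with h | h
      · exact absurd h (Complex.ofReal_ne_zero.2 (hD p.1))
      · rcases mul_eq_zero.1 h with h | h
        · rcases mul_eq_zero.1 h with h | h
          · exact absurd h (hs _)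
          · exact (map_eq_zero_iff _ (RingHom.injective _)).1 h
        · exact absurd h (inv_ne_zero (hs _))
    · exact absurd h (inv_ne_zero (Complex.ofReal_ne_zero.2 (hD n.1)))
  refine smul_x₀_eq_of_col_two _ fun m => ?_
  have h := hentry ⟨V.rationalFramePerm (Fin.castSucc m), pos_perm_castSucc V m⟩ ⟨V.rationalFramePerm 2, not_cmXV_cmPlace_perm_two_pos V⟩
  simpa only [Equiv.symm_apply_apply] using h

/-- **the inverse lettering** `Π_w U(V⁺_w) × U(V⁻_w) →* K_∞`. -/
def lettInv :
    (∀ w : {v : InfinitePlace ↥(maximalRealSubfield L) // v.IsReal},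
      Matrix.unitaryGroup (PosIdx (cmXV (L : Type) (frameD V) (frameD_real V) ι₁ w)) ℂ ×
        Matrix.unitaryGroup (NegIdx (cmXV (L : Type) (frameD V) (frameD_real V) ι₁ w)) ℂ) →* ↥(KInfty V) :=
  (lettInvArch V S).codRestrict (KInfty V) (lettInvArch_mem V S)

/-- (Ported verbatim from the HodgeCMPerL package; no docstring in the source.) -/
theorem coe_lettInv
    (a : ∀ w : {v : InfinitePlace ↥(maximalRealSubfield L) // v.IsReal},
      Matrix.unitaryGroup (PosIdx (cmXV (L : Type) (frameD V) (frameD_real V) ι₁ w)) ℂ ×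
        Matrix.unitaryGroup (NegIdx (cmXV (L : Type) (frameD V) (frameD_real V) ι₁ w)) ℂ) :
    ((lettInv V S a : ↥(KInfty V)) : UnitaryGroup.arch (↥(maximalRealSubfield L)) (L : Type) (IsCMField.complexConj L) 3 V.Hm) =
      lettInvArch V S a := rfl

/-- `lett ∘ lettInv = id`. -/
theorem lett_lettInv
    (a : ∀ w : {v : InfinitePlace ↥(maximalRealSubfield L) // v.IsReal},
      Matrix.unitaryGroup (PosIdx (cmXV (L : Type) (frameD V) (frameD_real V) ι₁ w)) ℂ ×
        Matrix.unitaryGroup (NegIdx (cmXV (L : Type) (frameD V) (frameD_real V) ι₁ w)) ℂ) :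
    lett V S (lettInv V S a) = a := by
  funext w
  apply UForm.kV_injective
  have h1 := congrArg Prod.fst (κ_lett_apply V S (lettInv V S a) w)
  have h2 := congrArg Prod.fst (cmPlaceComponent_letterSection (L : Type) (frameD V) (frameD_real V) (frameD_ne V) (dW S)
    (dW_real S) (dW_ne S) ι₁ w (fun w => (a w, (1, 1))))
  rw [kPairHom_apply, cmPlaceComponent_fst, coe_lettInv, archFrameConj_lettInvArch] at h1
  rw [cmPlaceComponent_fst] at h2
  have h1' : UForm.kV _ _ (lett V S (lettInv V S a) w) = _ := h1
  have h2' : _ = UForm.kV _ _ (a w) := h2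
  exact h1'.trans h2'

/-- `lettInv ∘ lett = id`. -/
theorem lettInv_lett (k : ↥(KInfty V)) : lettInv V S (lett V S k) = k := by
  apply Subtype.ext
  apply (archFrameConjEquiv (L : Type) 3 V.Hm (frameG V) (frameD V) (frame_congr V)).injective
  rw [archFrameConjEquiv_apply, archFrameConjEquiv_apply, coe_lettInv, archFrameConj_lettInvArch, letterSection_lett]

/-- **`K_∞ ≃* Π_w U(V⁺_w) × U(V⁻_w)`**: the lettering of #50 is a bijection. -/
def lettEquiv :
    ↥(KInfty V) ≃*
      ∀ w : {v : InfinitePlace ↥(maximalRealSubfield L) // v.IsReal},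
        Matrix.unitaryGroup (PosIdx (cmXV (L : Type) (frameD V) (frameD_real V) ι₁ w)) ℂ ×
          Matrix.unitaryGroup (NegIdx (cmXV (L : Type) (frameD V) (frameD_real V) ι₁ w)) ℂ :=
  { lett V S with
    invFun := lettInv V S
    left_inv := lettInv_lett V S
    right_inv := lett_lettInv V S }

/-- (Ported verbatim from the HodgeCMPerL package; no docstring in the source.) -/
@[simp] theorem lettEquiv_apply (k : ↥(KInfty V)) : lettEquiv V S k = lett V S k := rfl

/-- (Ported verbatim from the HodgeCMPerL package; no docstring in the source.) -/
theorem lett_surjective : Function.Surjective (lett V S) := (lettEquiv V S).surjective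

end Pin

end HodgeCM.Model.HypCensus

end
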